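import Literature.MathematicalPhysics.QuantumFieldTheory.Balaban1983to89.B9Eq3126H1kLipschitzEnergyDiagonal
import Literature.MathematicalPhysics.QuantumFieldTheory.Balaban1983to89.B9Eq3126H1BoundTowerVariational

/-!
# `Balaban1983to89.B9Eq3126H1kLipschitzEnergyClosed` — T. Bałaban, *Propagators for lattice gauge theories in a background field*, Commun. Math. Phys.
# **99** (1985) 389–434 [Balaban1985BackgroundPropagators] (3.126) p. 420 *«HB = GQ*(QGQ*)⁻¹B»* with Thm 3.11 p. 416 ∕ (3.84)–(3.86) p. 407 AT `k = n+1`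
# AVERAGING LEVELS ON PRINT's DIAGONAL `ηL^{n+1} = 1`, and T. Bałaban, *The variational problem and background fields in renormalization group method for
# lattice gauge theories*, Commun. Math. Phys. **102** (1985) 277–309 [Balaban1985Variational] (45)–(46) p. 285: **`H_{1,k}(U) − H_{1,k}(1) = O(α)` IN THE
# FLAT ENERGY NORM WITH THE TWO `(Q_kG_kQ_k†)⁻¹`-LETTERS INHABITED — `∃ α₀ C` CLOSED IN `(d, a, L, M_φ, M_φ′, r, C_τ, ρ_w, C_R)`, MODULO THE `R`-LETTER
# `C_R` ONLY** (the closing corollary of the NE9 owner's `B9Eq3126H1kLipschitzEnergyDiagonal` with `C_{K,1} := Ξ(d,a)` from `B9Eq3126KFloorTowerDiagonal`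
# and `C_{K,U}` from `B9Eq3126H1BoundTowerVariational`)

statement-level skeleton of published theorems with citation tags; proofs where landed; nothing here is a claim about the Yang–Mills mass gap

CITATION HEADER (lean-in-tree rule).  Audit cell `pub-balaban`, sub-cell `t4`, BINDER row NE9; filed by NE9 formalisation-swarm LEAF PROVER 02
(`b2b-balaban-t4-ne9-formalise-leaf-02`, gen 66) on the row OWNER `b2b-balaban-t4-ne9-p1`'s energy-currency chain (gen 86: `B9Eq353FormDefectTowerDiagonal`,
`B9Eq3126H1LipschitzEnergy`, `B9Eq3126H1kLipschitzEnergyDiagonal` — the host, whose closing corollary was offered to this lineage).  Sources READ first-hand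
in the held text layer [Balaban1985BackgroundPropagators] (`paper:balaban1985-cmp99-background-propagators`, journal page = PDF page + 388) pp. 400 (Thm 3.4),
406 ((3.79)), 407 ((3.82)–(3.86)), 416 (Thm 3.11), 420 ((3.126)); [Balaban1985Variational] (45)–(46) p. 285 via the tree's quotations.
THE PRINT (verbatim): [B9] p. 420 *«HB = GQ*(QGQ*)⁻¹B»*; [B11] p. 285 *«… the Theorem 3.12 from [5] implies |HB| ≤ B₀(L^jη)^{−1}|B|»* with `B₀` uniform in
the lattice and in `j`; [B9] p. 416, Thm 3.11: *«There exist positive constants α₀, γ₀ such that for U satisfying (3.79) with arbitrary α₁ ≤ α₀ … the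
operators Δ′_a, G′, (Q′G′²Q′*)⁻¹, Δ_a, G are positive definite … and … uniformly bounded»*; p. 400 Thm 3.4 *«small perturbations of the operators depending
on U only»*.

WHY THIS FILE (cell context).  The host `B9Eq3126H1kLipschitzEnergyDiagonal.exists_norm_H1k_sub_flat_le_diagonal_closed` bounds `H_{1,k}(U)b − H_{1,k}(1)b`
and its flat `D`-rows by `Cα‖b‖` with `C` closed in `(d, a, L, M_φ, M_φ′, r, C_τ, ρ_w, C_R, C_{K,1}, C_{K,U})`, the two `K⁻¹`-letters
`‖(Q_kG_k(1)Q_k†)⁻¹b‖ ≤ C_{K,1}‖b‖`, `‖(Q_kG_k(U)Q_k†)⁻¹c‖ ≤ C_{K,U}‖c‖` DISPLAYED.  This lineage's variational currency inhabits both on the diagonal: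
`C_{K,1} = Ξ(d,a) = 180d·1215²(27²∕4²)^{d−1} + 2a(1215∕12)²(27²∕6²)^{d−1}` (`B9Eq3126KFloorTowerDiagonal.norm_KinvLatticeK_H1LatticeK_tower_one_le_diagonal`,
first conjunct, at the canonical flat tower data; its displayed coercivity `γ` read from the OWNER's `B9Eq326OperatorTowerFlatExplicit.coercive_laplaceAk_one_explicit`
— immaterial for the `K⁻¹`-letter but a binder of the theorem) and `C_{K,U}` closed in `(d, a, L, M_φ, M_φ′, r, C_τ, ρ_w)` for every background in the
three windows (`B9Eq3126H1BoundTowerVariational.exists_norm_KinvLatticeK_H1LatticeK_le_diagonal_closed`, first conjunct).  The transporter adjointness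
`hRS` of the host is DERIVED from unitarity `U(b)* = U(b)⁻¹` and the compatibility of the `*`-trace with the Hilbert norming
(`B9Eq310HessianHermitian.adTransportW_adjoint`), as in `B9Eq3126H1BoundTowerVariational`.  What stays displayed: the `R`-letter `C_R` (the OWNER's
TOWER-R-PROGRAMME), the windows, `1 ≤ d`, `3 ≤ L^{n+1}`, `|η|^d∕c₀ ≤ ρ_w`, the trace letters, and ANY positivity ∕ onto witnesses `hposU`, `hpos1`, `hQU`, `hQ1`
(inhabited on the diagonal by the OWNER's `exists_laplaceAk_pos_diagonal_closed` ∕ `QkW_surjective`; the conclusion does not depend on the choice).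

WHAT IS PROVED (sorry-free; 0 `def`; [folklore] composition BY NAME of three landed theorems; nothing of [B9]∕[B11] asserted as printed).
* **`exists_norm_H1k_sub_flat_le_closed`** — `∃ α₀ C > 0` (closed in `(d, a, L, M_φ, M_φ′, r, C_τ, ρ_w, C_R)`) such that for every `n` (`3 ≤ L^{n+1}`), `η`
  (`ηL^{n+1} = 1`), `c₀, c₁` (`c₀(L^{n+1})^d = c₁`, `|η|^d∕c₀ ≤ ρ_w`), `m`, background `U` of E162's data, unitary, `U(b) ∈ U1`, in the windows
  `‖U(b) − 1‖ ≤ αη`, `‖U(∂p) − 1‖ ≤ αη²`, `‖Ū^j(b) − 1‖ ≤ ε_j ≤ αr^j` with `0 ≤ α ≤ α₀`, the `R`-letter `‖R_k(U)s − R_k(1)s‖ ≤ C_Rα‖s‖`, ANY `hposU`,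
  `hpos1`, `hQU`, `hQ1`, and every block field `b`: `‖H_k(U)b − H_k(1)b‖ ≤ Cα‖b‖`, `‖curl₁(H_k(U)b − H_k(1)b)‖ ≤ Cα‖b‖`, `‖div₁(H_k(U)b − H_k(1)b)‖ ≤ Cα‖b‖`
  (the flat `H_k(1) = H1LatticeK` with its implicit letters written out, verbatim as in the host).
HONEST SCOPE.  FIRST order at the flat point on the diagonal ONLY; the `L²`∕energy clause — no kernel bound, no decay, NOT [B9] Thm 3.12, NOT the (N)-reading;
crude constants; `C_R`, the windows, the trace letters, `ρ_w`, the positivity and onto witnesses stay HYPOTHESES.  NOT summit progress (cell pub-balaban: NE9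
NOT PRINTED ∕ NOT PROVED; «NE9 ⇐ the named binders»; row WALLED ON A MODEL (O-NE9-1; #5 UNRULED); spine PROVED 0∕9; rung (B)+1 finite T⁴ — NOT infinite
volume, NOT mass gap, NOT BetaPertH, NOT Clay).  HONEST DEPENDENCY (cell line): continuum YM on T⁴ ⇐ BetaPertH ∧ nine spine estimates (0/9 proved); BetaPertH ⇐
(D1) ∧ (D4) ∧ CAP+tail; G-an2-4 gates asym, D1 and NE2/3/4.  NEW file importing `B9Eq3126H1kLipschitzEnergyDiagonal` (OWNER) and `B9Eq3126H1BoundTowerVariational`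
(this lineage; it carries `B9Eq3126KFloorTowerDiagonal`); nothing modified.  Net new unproved facts: 0.
-/

noncomputable section

open scoped InnerProductSpace ComplexConjugate BigOperators

namespace Literature.MathematicalPhysics.QuantumFieldTheory.Balaban1983to89.B9Eq3126H1kLipschitzEnergyClosed

open B4Sect5Torus (TSite)
open B9SectCLatticeCarrier (Bond)
open B11Eq103H1Complex (SiteL2K BondL2K covDivL2K H1LatticeK KinvLatticeK)
open B9Eq310HessianOperator (adTransportW hessOp covCurlL2K)
open B9Eq310HessianHermitian (adTransportW_adjoint)
open B9Eq310DeltaPrime (plaqHolU)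
open B9Eq315QTorus (perCfg cornerSite)
open B9Eq315QTower (towerP UlevOf)
open B9Eq315QTowerFlat (perCfg_UlevOf_one_mem_U1 norm_Wcx_UlevOf_one_sub_one_le)
open B9Eq315QTowerFlatNorm (flat_oneStep_data_pow)
open B9Eq316TowerFlatIsOneStep (towerP_eq_fineP_pow)
open B9Eq326OperatorTower (laplaceAk QkW RofUk)
open B9Eq326OperatorTowerFlatExplicit (coercive_laplaceAk_one_explicit)
open B7Prop1Explicit (U1 Wcx boxVec)
open B9Eq3126KFloorTowerDiagonal (norm_KinvLatticeK_H1LatticeK_tower_one_le_diagonal)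
open B9Eq3126H1BoundTowerVariational (exists_norm_KinvLatticeK_H1LatticeK_le_diagonal_closed)
open B9Eq3126H1kLipschitzEnergyDiagonal (exists_norm_H1k_sub_flat_le_diagonal_closed)

variable {d : ℕ} (hd : 1 ≤ d) (L : ℕ) [NeZero L] (hL : 1 ≤ L)
  {𝔸 : Type*} [NormedRing 𝔸] [NormedAlgebra ℂ 𝔸] [CompleteSpace 𝔸] [NormOneClass 𝔸] [StarRing 𝔸] [NormedStarGroup 𝔸] [StarModule ℂ 𝔸]
  {W : Type*} [NormedAddCommGroup W] [InnerProductSpace ℂ W] [FiniteDimensional ℂ W] (φ : W ≃ₗ[ℂ] 𝔸)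
  {Mφ Mφ' : ℝ} (hMφ : 0 ≤ Mφ) (hMφ' : 0 ≤ Mφ') (hφ : ∀ w, ‖φ w‖ ≤ Mφ * ‖w‖) (hφ' : ∀ X, ‖φ.symm X‖ ≤ Mφ' * ‖X‖)
  {a : ℝ} (ha : 0 < a) {r : ℝ} (hr0 : 0 ≤ r) (hr1 : r < 1)
  (τ : 𝔸 →ₗ[ℂ] ℂ) {Cτ : ℝ} (hτ : ∀ X, ‖τ X‖ ≤ Cτ * ‖X‖) (hCτ : 0 ≤ Cτ) {ρw : ℝ} (hρw : 0 ≤ ρw) {CR : ℝ} (hCR : 0 ≤ CR)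
  (hτ₁ : ∀ X : 𝔸, τ (star X) = conj (τ X)) (hτ₂ : ∀ X Y : 𝔸, τ (X * Y) = τ (Y * X))
  (hφτ : ∀ X Y : 𝔸, ⟪φ.symm X, φ.symm Y⟫_ℂ = τ (star X * Y))

include hd hMφ hMφ' hφ hφ' ha hr0 hr1 hτ hCτ hρw hCR hτ₁ hτ₂ hφτ

/-- **`H_{1,k}(U) − H_{1,k}(1) = O(α)` IN THE FLAT ENERGY NORM ON THE DIAGONAL, MODULO `C_R` ONLY — THE TWO `K⁻¹`-LETTERS INHABITED**: there are
`α₀, C > 0` (closed in `(d, a, L, M_φ, M_φ′, r, C_τ, ρ_w, C_R)`) such that for every `n` with `3 ≤ L^{n+1}`, `η` (`ηL^{n+1} = 1`), `c₀, c₁`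
(`c₀(L^{n+1})^d = c₁`, `|η|^d∕c₀ ≤ ρ_w`), `m`, background `U` of E162's data which is unitary (`U(b)* = U(b)⁻¹`), `U(b) ∈ U1`, in the windows
`‖U(b) − 1‖ ≤ αη`, `‖U(∂p) − 1‖ ≤ αη²`, `‖Ū^j(b) − 1‖ ≤ ε_j ≤ αr^j`, `0 ≤ α ≤ α₀`, with the `R`-letter `‖R_k(U)s − R_k(1)s‖ ≤ C_Rα‖s‖`, ANY positivity
witnesses `hposU`, `hpos1`, ANY onto-witnesses `hQU`, `hQ1`, and every block field `b`: `‖H_k(U)b − H_k(1)b‖ ≤ Cα‖b‖`,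
`‖curl₁(H_k(U)b − H_k(1)b)‖ ≤ Cα‖b‖`, `‖div₁(H_k(U)b − H_k(1)b)‖ ≤ Cα‖b‖` — the host `exists_norm_H1k_sub_flat_le_diagonal_closed` with
`C_{K,1} := Ξ(d,a)` (`norm_KinvLatticeK_H1LatticeK_tower_one_le_diagonal` at the canonical flat tower data, `γ` read from `coercive_laplaceAk_one_explicit`),
`C_{K,U}` from `exists_norm_KinvLatticeK_H1LatticeK_le_diagonal_closed`, `hRS` from unitarity (`adTransportW_adjoint`); `α₀` the minimum of the two ceilings.
[folklore] [cite: Balaban1985BackgroundPropagators, (3.126) p.420, Thm 3.11 p.416, Thm 3.4 p.400, (3.84)–(3.86) p.407, (3.79) p.406; Balaban1985Variational, (45)–(46) p.285] -/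
theorem exists_norm_H1k_sub_flat_le_closed :
    ∃ α₀ C : ℝ, 0 < α₀ ∧ 0 < C ∧ ∀ (n : ℕ) (η : ℝ), η * (L : ℝ) ^ (n + 1) = 1 → 3 ≤ L ^ (n + 1) →
      ∀ (c₀ c₁ : ℝ) [Fact (0 < c₀)] [Fact (0 < c₁)], c₀ * ((L : ℝ) ^ (n + 1)) ^ d = c₁ → |η| ^ d / c₀ ≤ ρw →
      ∀ (m : Fin d → ℕ) [∀ i, NeZero (m i)] (U : Bond d (towerP L m (n + 1)) → 𝔸ˣ) (αU : ℕ → ℝ) (hα1 : ∀ j, αU j ≤ 1 / 64)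
        (hU1 : ∀ (j : ℕ) (x : B7Prop1Explicit.Site d) (κ : Fin d), perCfg (towerP L m (j + 1)) (UlevOf L m (n + 1) U j) x κ ∈ U1 𝔸)
        (hreg : ∀ (j : ℕ) (y : TSite d (towerP L m j)) (κ : Fin d) (r : Fin d → Fin L),
          ‖((Wcx L (perCfg (towerP L m (j + 1)) (UlevOf L m (n + 1) U j)) (cornerSite L y) κ (boxVec L r) : 𝔸ˣ) : 𝔸) - 1‖ ≤ αU j)
        (εU : ℕ → ℝ), (∀ j, 0 ≤ εU j) → (∀ (j : ℕ) (b : Bond d (towerP L m (j + 1))), ‖(UlevOf L m (n + 1) U j b : 𝔸) - 1‖ ≤ εU j) →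
      ∀ {α : ℝ}, 0 ≤ α → α ≤ α₀ →
        (∀ b, star (U b : 𝔸) = (((U b)⁻¹ : 𝔸ˣ) : 𝔸)) →
        (∀ b, U b ∈ U1 𝔸) → (∀ b, ‖(U b : 𝔸) - 1‖ ≤ α * η) →
        (∀ p : B9SectCLatticeCarrier.Plaq d (towerP L m (n + 1)), ‖(plaqHolU U p : 𝔸) - 1‖ ≤ α * η ^ 2) →
        (∀ j < n + 1, εU j ≤ α * r ^ j) →
        (∀ s : SiteL2K ℂ d (towerP L m (n + 1)) c₀ W,
          ‖RofUk L m n φ η U s - RofUk L m n φ η (fun _ : Bond d (towerP L m (n + 1)) => (1 : 𝔸ˣ)) s‖ ≤ CR * α * ‖s‖) →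
        ∀ (hposU : ∀ x : BondL2K ℂ d (towerP L m (n + 1)) c₀ W, x ≠ 0 →
            0 < RCLike.re ⟪x, laplaceAk L m n φ η U hL αU hα1 hU1 hreg τ (c₀ := c₀) (c₁ := c₁) a x⟫_ℂ)
          (hpos1 : ∀ x : BondL2K ℂ d (towerP L m (n + 1)) c₀ W, x ≠ 0 →
            0 < RCLike.re ⟪x, laplaceAk L m n φ η (fun _ : Bond d (towerP L m (n + 1)) => (1 : 𝔸ˣ)) hL (fun _ => 0) (fun _ => by norm_num)
              (perCfg_UlevOf_one_mem_U1 L m (n + 1)) (norm_Wcx_UlevOf_one_sub_one_le L m (n + 1) (fun _ => 0) (fun _ => le_rfl)) τ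
              (c₀ := c₀) (c₁ := c₁) a x⟫_ℂ)
          (hQU : Function.Surjective (QkW L m n φ U hL αU hα1 hU1 hreg (c₀ := c₀) (c₁ := c₁)))
          (hQ1 : Function.Surjective (QkW L m n φ (fun _ : Bond d (towerP L m (n + 1)) => (1 : 𝔸ˣ)) hL (fun _ => 0) (fun _ => by norm_num)
            (perCfg_UlevOf_one_mem_U1 L m (n + 1)) (norm_Wcx_UlevOf_one_sub_one_le L m (n + 1) (fun _ => 0) (fun _ => le_rfl)) (c₀ := c₀) (c₁ := c₁))),
        ∀ b : BondL2K ℂ d m c₁ W,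
          ‖H1LatticeK hposU hQU b - H1LatticeK (c := ((η : ℂ))⁻¹) (R := adTransportW φ (fun _ : Bond d (towerP L m (n + 1)) => (1 : 𝔸ˣ)))
              (S := adTransportW φ fun _ : Bond d (towerP L m (n + 1)) => (1 : 𝔸ˣ)⁻¹) (Δ₁ := hessOp φ η (fun _ : Bond d (towerP L m (n + 1)) => (1 : 𝔸ˣ)) τ)
              (Rr := RofUk L m n φ η (fun _ : Bond d (towerP L m (n + 1)) => (1 : 𝔸ˣ)))
              (Q := (QkW L m n φ (fun _ : Bond d (towerP L m (n + 1)) => (1 : 𝔸ˣ)) hL (fun _ => 0) (fun _ => by norm_num)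
            (perCfg_UlevOf_one_mem_U1 L m (n + 1)) (norm_Wcx_UlevOf_one_sub_one_le L m (n + 1) (fun _ => 0) (fun _ => le_rfl)) (c₀ := c₀) (c₁ := c₁))) (a := a) hpos1 hQ1 b‖ ≤ C * α * ‖b‖ ∧
          ‖covCurlL2K ℂ c₀ ((η : ℂ))⁻¹ (adTransportW φ (fun _ : Bond d (towerP L m (n + 1)) => (1 : 𝔸ˣ)))
            (H1LatticeK hposU hQU b - H1LatticeK (c := ((η : ℂ))⁻¹) (R := adTransportW φ (fun _ : Bond d (towerP L m (n + 1)) => (1 : 𝔸ˣ)))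
              (S := adTransportW φ fun _ : Bond d (towerP L m (n + 1)) => (1 : 𝔸ˣ)⁻¹) (Δ₁ := hessOp φ η (fun _ : Bond d (towerP L m (n + 1)) => (1 : 𝔸ˣ)) τ)
              (Rr := RofUk L m n φ η (fun _ : Bond d (towerP L m (n + 1)) => (1 : 𝔸ˣ)))
              (Q := (QkW L m n φ (fun _ : Bond d (towerP L m (n + 1)) => (1 : 𝔸ˣ)) hL (fun _ => 0) (fun _ => by norm_num)
            (perCfg_UlevOf_one_mem_U1 L m (n + 1)) (norm_Wcx_UlevOf_one_sub_one_le L m (n + 1) (fun _ => 0) (fun _ => le_rfl)) (c₀ := c₀) (c₁ := c₁))) (a := a) hpos1 hQ1 b)‖ ≤ C * α * ‖b‖ ∧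
          ‖covDivL2K ℂ c₀ ((η : ℂ))⁻¹ (adTransportW φ fun _ : Bond d (towerP L m (n + 1)) => (1 : 𝔸ˣ)⁻¹)
            (H1LatticeK hposU hQU b - H1LatticeK (c := ((η : ℂ))⁻¹) (R := adTransportW φ (fun _ : Bond d (towerP L m (n + 1)) => (1 : 𝔸ˣ)))
              (S := adTransportW φ fun _ : Bond d (towerP L m (n + 1)) => (1 : 𝔸ˣ)⁻¹) (Δ₁ := hessOp φ η (fun _ : Bond d (towerP L m (n + 1)) => (1 : 𝔸ˣ)) τ)
              (Rr := RofUk L m n φ η (fun _ : Bond d (towerP L m (n + 1)) => (1 : 𝔸ˣ)))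
              (Q := (QkW L m n φ (fun _ : Bond d (towerP L m (n + 1)) => (1 : 𝔸ˣ)) hL (fun _ => 0) (fun _ => by norm_num)
            (perCfg_UlevOf_one_mem_U1 L m (n + 1)) (norm_Wcx_UlevOf_one_sub_one_le L m (n + 1) (fun _ => 0) (fun _ => le_rfl)) (c₀ := c₀) (c₁ := c₁))) (a := a) hpos1 hQ1 b)‖ ≤ C * α * ‖b‖ := by
  -- the `K⁻¹(U)`-letter of this lineage, closed in `(d, a, L, M_φ, M_φ′, r, C_τ, ρ_w)`
  obtain ⟨αK, CKU, CH, hαK, hCKU, -, HK⟩ :=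
    exists_norm_KinvLatticeK_H1LatticeK_le_diagonal_closed hd L hL φ hMφ hMφ' hφ hφ' ha hr0 hr1 τ hτ hCτ hρw hτ₁ hτ₂ hφτ
  -- the `K⁻¹(1)`-letter `Ξ(d, a)`
  have hΞ : (0 : ℝ) ≤ 180 * (d : ℝ) * 1215 ^ 2 * ((27 : ℝ) ^ 2 / 4 ^ 2) ^ (d - 1) + 2 * a * (1215 / 12) ^ 2 * ((27 : ℝ) ^ 2 / 6 ^ 2) ^ (d - 1) := by
    positivity
  -- the host, at these two letters
  obtain ⟨αE, C, hαE, hC, HE⟩ :=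
    exists_norm_H1k_sub_flat_le_diagonal_closed (d := d) L hL φ hMφ hMφ' hφ hφ' ha hr0 hr1 τ hτ hCτ hρw hCR hΞ hCKU.le
  refine ⟨min αK αE, C, lt_min hαK hαE, hC, ?_⟩
  intro n η hηL hL3 c₀ c₁ _ _ hw hρ m _ U αU hα1 hU1 hreg εU hεU hUε α hα0 hαle hUst hUb hUη hpl hεg hR hposU hpos1 hQU hQ1 b
  have hc₁ : 0 < c₁ := Fact.out
  have hαK' : α ≤ αK := hαle.trans (min_le_left _ _)
  have hαE' : α ≤ αE := hαle.trans (min_le_right _ _)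
  -- `hRS` from unitarity and the trace letters
  have hRS : ∀ (b : Bond d (towerP L m (n + 1))) (v u : W), ⟪adTransportW φ U b v, u⟫_ℂ = ⟪v, adTransportW φ (fun b => (U b)⁻¹) b u⟫_ℂ :=
    adTransportW_adjoint φ τ hτ₂ hUst hφτ
  -- the `K⁻¹(U)`-letter
  have hKU : ∀ c : BondL2K ℂ d m c₁ W, ‖KinvLatticeK hposU hQU c‖ ≤ CKU * ‖c‖ :=
    (HK n η hηL hL3 c₀ c₁ hw hρ m U αU hα1 hU1 hreg εU hεU hUε hα0 hαK' hUst hUb hUη hpl hεg hposU hQU).1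
  -- the `K⁻¹(1)`-letter: the flat tower port at the canonical flat data, `γ` read from the OWNER's explicit flat constant at print's point
  have hη0 : η ≠ 0 := by
    intro h0; rw [h0, zero_mul] at hηL; exact zero_ne_one hηL
  have hη' : η * (((L ^ (n + 1) : ℕ) : ℝ)) = 1 := by rwa [Nat.cast_pow]
  have hw' : c₀ * (((L ^ (n + 1) : ℕ) : ℝ)) ^ d = c₁ := by rwa [Nat.cast_pow]
  have hLk : 1 ≤ L ^ (n + 1) := Nat.one_le_pow _ _ hL
  obtain ⟨hU1', hreg'⟩ := flat_oneStep_data_pow (𝔸 := 𝔸) L m n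
  have ha'' : a * c₁ * (η * (L : ℝ) ^ (n + 1)) ^ 2 / (c₀ * ((L : ℝ) ^ (n + 1)) ^ d) = a := by
    rw [hηL, hw, one_pow, mul_one, mul_div_assoc, div_self hc₁.ne', mul_one]
  have hC1 : (1 : ℝ) ≤ B5Prop11Plancherel.Cst d a := B5Prop11Lower.one_le_Cst _
  have hγ : 0 < 1 / ((d + 1 : ℝ) * B5Prop11Plancherel.Cst d a) := by positivity
  have hcoer : ∀ x : BondL2K ℂ d (towerP L m (n + 1)) c₀ W, 1 / ((d + 1 : ℝ) * B5Prop11Plancherel.Cst d a) * ‖x‖ ^ 2 ≤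
      RCLike.re ⟪x, laplaceAk L m n φ η (fun _ : Bond d (towerP L m (n + 1)) => (1 : 𝔸ˣ)) hL (fun _ => 0) (fun _ => by norm_num)
        (perCfg_UlevOf_one_mem_U1 L m (n + 1)) (norm_Wcx_UlevOf_one_sub_one_le L m (n + 1) (fun _ => 0) (fun _ => le_rfl)) τ
        (c₀ := c₀) (c₁ := c₁) a x⟫_ℂ := by
    intro x
    have key := coercive_laplaceAk_one_explicit L m n hL φ (c₀ := c₀) (c₁ := c₁) (fun _ => 0) (fun _ => by norm_num)
      (perCfg_UlevOf_one_mem_U1 L m (n + 1)) (norm_Wcx_UlevOf_one_sub_one_le L m (n + 1) (fun _ => 0) (fun _ => le_rfl)) hη0 ha τ x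
    rw [ha'', hηL, inv_one, one_pow, mul_one] at key
    exact key
  have hK1 := (norm_KinvLatticeK_H1LatticeK_tower_one_le_diagonal L m n hL φ η τ (fun _ => 0) (fun _ => by norm_num)
    (perCfg_UlevOf_one_mem_U1 L m (n + 1)) (norm_Wcx_UlevOf_one_sub_one_le L m (n + 1) (fun _ => 0) (fun _ => le_rfl)) hLk
    (by norm_num : (0 : ℝ) ≤ 1 / 64) hU1' hreg' (towerP_eq_fineP_pow L m (n + 1)) hL3 hd hη' hw' ha hγ hcoer hpos1 hQ1).1
  exact HE n η hηL c₀ c₁ hw hρ m U αU hα1 hU1 hreg εU hεU hUε hα0 hαE' hRS hUb hUη hpl hεg hR hposU hpos1 hQU hQ1 hK1 hKU b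

end Literature.MathematicalPhysics.QuantumFieldTheory.Balaban1983to89.B9Eq3126H1kLipschitzEnergyClosed

end
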